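import Literature.MathematicalPhysics.QuantumFieldTheory.Balaban1983to89.B9B8KnitLetterTransferReg335
import Literature.MathematicalPhysics.QuantumFieldTheory.Balaban1983to89.B9B8KnitBondCLettersAtPars
import Literature.MathematicalPhysics.QuantumFieldTheory.Balaban1983to89.B9Ineq349WordDiffHomWeighted

/-!
# `Balaban1983to89.B9B8KnitBondGpQLettersAtParsReg335` — T. Bałaban, *Propagators for lattice gauge theories in a background field*, Commun. Math. Phys.
# **99** (1985) 389–434 [Balaban1985BackgroundPropagators], (3.19) p. 393, (3.21) ∕ (3.24) p. 394, Thm 3.1 (3.42) p. 397 AT THE PAIR `(parSymY, parKnitY)` FOR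
# EVERY MEMBER OF THE LOCAL CLASS (3.35) p. 396: the `Q′`-SECTOR (J-B file 23a, t2s-1's 5a §1) and the `G′`-SECTOR (p38's 2c-i `B9B8KnitBondGpLettersAtPars`)
# of the bond-sector knit junction WITHOUT [5]'s global (52) — the two-space left ∕ right entries at the knit letter and the DIFFERENCED entries, with the
# LEVEL-WEIGHTED block-diagonal letter `E` of `B9B8KnitLetterTransferReg335`

statement-level skeleton of published theorems with citation tags; proofs where landed; nothing here is a claim about the Yang–Mills mass gap

THE PRINT.  (3.19) p. 393 (the knit transporters «(52), (53) in [5]»), (3.21) ∕ (3.24) p. 394 (`Q′`, `Q′*`), Thm 3.1 (3.42) p. 397, (3.35) p. 396 (the local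
class), (3.90) pp. 409–410, (3.106) p. 414; [4] Prop. 2.2 (2.50)–(2.52) p. 232, Lemma 2.1 (2.60)–(2.61) p. 234; [5] (17)–(20) pp. 20–21, (44) p. 24, (52)–(53)
pp. 26–27.

WHY THIS FILE (cell `pub-ymgap`, node N06, seat `dag-n06-j` gen 36; file 2 of the chain «Thm 3.3's block at `parKnitY` on (3.35)»).  The bond-sector junction
`B9B8KnitBondWordDiff.hasMajorant_conj_DPDsY_sub` (any two tables) is fed, at `(parSymY, parKnitY)`, by thirteen member-level letter majorants which t2s-1 ∕ p38
discharged under the GLOBAL (52) (`B9B8KnitBondGpLettersAtPars`, `B9B8KnitBondCLettersAtPars`).  On the LOCAL class (3.35) the same letters hold member by member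
with [5]'s (52) replaced by `U ∈ (bg9KP … G i).Reg335 c₀ α₀` + the x-free knit numerics `0 < α₀′`, `C₀α₀′ ≤ ⅓`, `2α₀′ ≤ c₂′`, `K_pl(Mα₀)L⁴ < α₀′` (n06-l's two local
lemmas), the block-diagonal `E` carrying the level weight `ℓ(a)⁻²` (file 1).  THIS FILE supplies the `Q′`-sector and the `G′`-sector; FILE 2a's generic
`leftDiff` ∕ `rightDiff` re-run for the WEIGHTED `E` are `B9Ineq349WordDiffHomWeighted` — the weight `ℓ(a)⁻²` of `E` cancels the `ℓ(a)²` of the neighbouring `G′`-letter EXACTLY (the (52)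
originals spent `ℓ ≤ 1` there), so every output has the (52) shape and constant.

WHAT IS PROVED (sorry-free; 0 `def`).
* §1 (`Q′`-sector on (3.35)) `parKnitY_bicontractive_reg335`, `hasMajorantHom_conjHom_QpY_parKnitY_reg335` ∕ `_QpsY_parKnitY_reg335`,
  `norm_qpT_sym_sub_knit_le_reg335`, ★★ `hasMajorantHom_conjHom_QpY_sym_sub_knit_reg335` ∕ `_QpsY_…` and `…_QpY_sub_pars_reg335` ∕ `_QpsY_…`
  (`𝟙[a = a′]·16(d+1)²α₀′M₂Σ‖b_j‖`, the two spellings `conĵ(Q′_S − Q′_K)` and `conĵQ′_S − conĵQ′_K`).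
* §2 (`G′`-sector on (3.35)) ★★ `hasMajorantHom_leftEntry_parKnitY_reg335` (`conĵ(D_U)∘conj b(η²G′_K) ≺ A₁(1 + c₁θc₁(1−θc₁)⁻¹)·ℓ·e^{−(1−α)δ₀d}`),
  ★★★ `hasMajorantHom_leftEntry_sym_sub_knit_reg335`, ★★★ `hasMajorantHom_rightEntry_sym_sub_knit_reg335` — p38's 2c-i conclusions VERBATIM on (3.35).
HONEST SCOPE.  Re-reading of landed estimates (J-B 23a, p38 2c-i, FILE 2a) through n06-l's local lemmas and file 1; the displayed `parSymY`-side data (M5.5's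
(3.42)₁ majorant `A·ℓ²·e^{−δ₀d}` and its `d + 1` directional left ∕ right products) stay hypotheses; helper, count-neutral; N06 NOT discharged; nothing continuum ∕
OS ∕ mass gap ∕ Clay — the Yang–Mills mass gap is NOT proved here.  No `sorry`, no `axiom`, no `instance`, no `notation`, no `def`.  NEW file.
RELATED, NOT DUPLICATED (searched 2026-08-30: `rg -l -w "GpQLettersAtParsReg335|leftDiff_w|sub_pars_reg335"` over `lean/Literature` = ∅): the (52) originals
`B9B8KnitBondGpLettersAtPars` ∕ `B9B8KnitBondCLettersAtPars` §1 ∕ `B9B8KnitLetterQpDiff` §3 ∕ `B9Ineq349WordDiffHom` (USED BY NAME for the algebra and the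
displayed-`δ` cores `hasMajorantHom_conjHom_QpY_sub`, `leftEntry_sub_eq`, `rightEntry_sub_eq`).
-/

noncomputable section

namespace Literature.MathematicalPhysics.QuantumFieldTheory.Balaban1983to89.B9B8KnitBondGpQLettersAtParsReg335

open Node00 B6KLevelCensusIndexV1 B6Geom246MultiLevelBox B9BackgroundsKLevelV1 B9Eq39Adjoint B9Thm311ReadingCoords B9Thm311DeltaPrimePos
open B6RandomWalk (HasMajorant Triangle254 Ineq261 Ineq263 hasMajorant_mono c1_nonneg)
open B6RandomWalkHom (HasMajorantHom hasMajorantHom_mono hasMajorantHom_iff hasMajorantHom_comp)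
open B6Ineq2142KLevelV1 (β)
open B9Thm34Ext (toB6 toB6_dist)
open B9GeoNormsKLevelV1 (geo9K geo9K_dist_nonneg)
open B9GeoLemma21KLevelV1 (geo9K_len_pos)
open B9Ineq347 (ScaleTransfer)
open B9Ineq349Hom (hasMajorantHom_rate_mono hasMajorantHom_comp_decay)
open B9Eq352DivFormLetters (conj conj_mul conj_sub conj_neg)
open B9Eq352GradLetters (diffLetter)
open B9Eq376POneLetters (conjHom conjHom_sub gradLin divLin)
open B9Eq376DerivDict (hasMajorantHom_gradLin hasMajorantHom_divLin)
open B9Ineq349SiteComposite (etaS_pos)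
open B7Prop1Explicit (U1 mem_U1)
open B7Prop2Explicit (C0 c2' unitaryUnits unitaryUnits_le_U1)
open B9B8AveragingJunction (parKnitY parKnitY_inv)
open B9Thm39CinvSandwichQ (hasMajorantHom_conjHom_QpY hasMajorantHom_conjHom_QpsY)
open B9B8KnitLetterQpDiff (hasMajorantHom_conjHom_QpY_sub hasMajorantHom_conjHom_QpsY_sub qpT_parSymY_bicontractive)
open B9B8KnitLetterMajorantTransfer (geo9K_len_sq_le_one)
open B9B8KnitBondGpLettersAtPars (leftEntry_sub_eq rightEntry_sub_eq hasMajorantHom_rightEntry_parSymY)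
open B9Ineq349WordDiffHomWeighted (hasMajorantHom_leftDiff_w hasMajorantHom_rightDiff_w)
open B9B8KnitLetterTransferReg335 (hasMajorant_conj_E_reg335 hasMajorant_conj_GpY_parKnitY_of_parSymY_reg335
  hasMajorant_left_conj_GpY_parKnitY_of_parSymY_reg335)
open B9B8KnitVsTaxicabReg335 (norm_parKnitY_sub_parSymY_le_of_reg335P)
open B9Eq3124HZKnitPairReg335Y (parKnitY_mem_unitary_of_reg335P)
open B9B8KnitLetterCoercive (contraction_of_mem_unitary)
open B9BackgroundsKLevelV1P (bg9KP mem_of_reg335P)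
open B9C2FormBoxRegimeY (Kpl)
open scoped Matrix Matrix.Norms.L2Operator



/-! ## §1 The `Q′`-sector at `(parSymY, parKnitY)` on the class (3.35) -/

section QLetters

variable {d ℓ : ℕ} {hd : 1 ≤ d + 1} {hL : Odd (ℓ + 1) ∧ 1 < ℓ + 1} {b₀ b₁ : ℝ}
variable (i : KIdx d ℓ hd hL b₀ b₁) {N : ℕ} {G : Subgroup (Matrix (Fin N) (Fin N) ℂ)ˣ}
variable {ι : Type} [Fintype ι] [DecidableEq ι] (b : Module.Basis ι ℝ (Matrix (Fin N) (Fin N) ℂ))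
variable [Fintype (geo9K i).Site] [DecidableEq (geo9K i).Site] {Rr : ℝ} {Hp : Prop} (ιB : BlkY i → IBondY i)

omit [Fintype ι] [DecidableEq ι] [Fintype (geo9K i).Site] [DecidableEq (geo9K i).Site] in
/-- the legs of print's knit letter `parKnitY` are contraction pairs for every member of the class (3.35) (n06-l: the knit legs are `U(N)`-valued on (3.35)).
[cite: Balaban1985BackgroundPropagators, (3.19) p.393, (3.35) p.396; Balaban1985Averaging, (52)–(53) pp.26–27, Prop. 2 p.26] -/
theorem parKnitY_bicontractive_reg335 [Nonempty (Fin N)]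
    (hG1 : ∀ u : (Matrix (Fin N) (Fin N) ℂ)ˣ, u ∈ G → ‖(u : Matrix (Fin N) (Fin N) ℂ)‖ ≤ 1) (hGU : G ≤ unitaryUnits (Matrix (Fin N) (Fin N) ℂ))
    {U : CfgY (Matrix (Fin N) (Fin N) ℂ) i} {c₀ α₀ : ℝ} (hc : c₀ ≤ 10) (hMα : 0 ≤ (kGeo i).M * α₀)
    (hreg : (bg9KP (Matrix (Fin N) (Fin N) ℂ) G i).Reg335 c₀ α₀ U) {α₀' : ℝ} (hα' : 0 < α₀') (hα3 : C0 (d + 1) * α₀' ≤ 1 / 3)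
    (hα2 : 2 * α₀' ≤ c2' (d + 1) (ℓ + 1)) (hK : Kpl i ((kGeo i).M * α₀) * (kGeo i).L ^ 4 < α₀') (z w : SiteY i) :
    ‖(parKnitY i U z w : Matrix (Fin N) (Fin N) ℂ)‖ ≤ 1 ∧ ‖(((parKnitY i U z w)⁻¹ : (Matrix (Fin N) (Fin N) ℂ)ˣ) : Matrix (Fin N) (Fin N) ℂ)‖ ≤ 1 :=
  contraction_of_mem_unitary le_rfl (parKnitY_mem_unitary_of_reg335P i hG1 hGU U hc hMα hreg hα' hα3 hα2 hK z w)

omit [Fintype ι] [DecidableEq ι] [Fintype (geo9K i).Site] [DecidableEq (geo9K i).Site] in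
/-- the `Q′`-transporters of the knit letter are contraction pairs on (3.35). [cite: Balaban1985BackgroundPropagators, (3.19) p.393, (3.21) p.394, (3.35) p.396] -/
theorem qpT_parKnitY_bicontractive_reg335 [Nonempty (Fin N)]
    (hG1 : ∀ u : (Matrix (Fin N) (Fin N) ℂ)ˣ, u ∈ G → ‖(u : Matrix (Fin N) (Fin N) ℂ)‖ ≤ 1) (hGU : G ≤ unitaryUnits (Matrix (Fin N) (Fin N) ℂ))
    {U : CfgY (Matrix (Fin N) (Fin N) ℂ) i} {c₀ α₀ : ℝ} (hc : c₀ ≤ 10) (hMα : 0 ≤ (kGeo i).M * α₀)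
    (hreg : (bg9KP (Matrix (Fin N) (Fin N) ℂ) G i).Reg335 c₀ α₀ U) {α₀' : ℝ} (hα' : 0 < α₀') (hα3 : C0 (d + 1) * α₀' ≤ 1 / 3)
    (hα2 : 2 * α₀' ≤ c2' (d + 1) (ℓ + 1)) (hK : Kpl i ((kGeo i).M * α₀) * (kGeo i).L ^ 4 < α₀') (s : BlkY i) (z : SiteY i) :
    ‖(qpT i (parKnitY i) U s z : Matrix (Fin N) (Fin N) ℂ)‖ ≤ 1 ∧
      ‖(((qpT i (parKnitY i) U s z)⁻¹ : (Matrix (Fin N) (Fin N) ℂ)ˣ) : Matrix (Fin N) (Fin N) ℂ)‖ ≤ 1 :=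
  contraction_of_mem_unitary le_rfl (parKnitY_mem_unitary_of_reg335P i hG1 hGU U hc hMα hreg hα' hα3 hα2 hK _ _)

omit [DecidableEq ι] in
/-- ★ `conĵQ′(U; parKnitY) ≺ 𝟙[a = a′]·M₂Σ_j‖b_j‖` on (3.35) — 2b's `hQ₂`. [cite: Balaban1985BackgroundPropagators, (3.21) p.394, (3.19) p.393, (3.35) p.396; Balaban1984PropagatorsII, (2.51) p.232] -/
theorem hasMajorantHom_conjHom_QpY_parKnitY_reg335 [Nonempty (Fin N)]
    (hG1 : ∀ u : (Matrix (Fin N) (Fin N) ℂ)ˣ, u ∈ G → ‖(u : Matrix (Fin N) (Fin N) ℂ)‖ ≤ 1) (hGU : G ≤ unitaryUnits (Matrix (Fin N) (Fin N) ℂ))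
    {U : CfgY (Matrix (Fin N) (Fin N) ℂ) i} {c₀ α₀ : ℝ} (hc : c₀ ≤ 10) (hMα : 0 ≤ (kGeo i).M * α₀)
    (hreg : (bg9KP (Matrix (Fin N) (Fin N) ℂ) G i).Reg335 c₀ α₀ U) {α₀' : ℝ} (hα' : 0 < α₀') (hα3 : C0 (d + 1) * α₀' ≤ 1 / 3)
    (hα2 : 2 * α₀' ≤ c2' (d + 1) (ℓ + 1)) (hK : Kpl i ((kGeo i).M * α₀) * (kGeo i).L ^ 4 < α₀') {M₂ : ℝ} (hM₂ : 0 ≤ M₂) (hrepr : ∀ (v : Matrix (Fin N) (Fin N) ℂ) (j : ι), |b.repr v j| ≤ M₂ * ‖v‖) :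
    HasMajorantHom (g := toB6 (geo9K i) Rr Hp) (fun p : SiteY i × ι => ιB (blkOf i.D.toDomains p.1)) (fun q : BlkY i × ι => ιB q.1)
      (conjHom b ((QpY i (parKnitY i) U).restrictScalars ℝ)) (fun a a' : (geo9K i).Site => if a = a' then M₂ * ∑ j, ‖b j‖ else 0) :=
  hasMajorantHom_conjHom_QpY i b ιB (parKnitY i) U (parKnitY_bicontractive_reg335 i hG1 hGU hc hMα hreg hα' hα3 hα2 hK) hM₂ hrepr

omit [DecidableEq ι] in
/-- ★ `conĵQ′*(U; parKnitY) ≺ 𝟙[a = a′]·M₂Σ_j‖b_j‖` on (3.35) — 2b's `hQs₂`. [cite: Balaban1985BackgroundPropagators, (3.24)–(3.25) p.394–395, (3.19) p.393, (3.35) p.396; Balaban1984PropagatorsII, (2.51) p.232] -/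
theorem hasMajorantHom_conjHom_QpsY_parKnitY_reg335 [Nonempty (Fin N)]
    (hG1 : ∀ u : (Matrix (Fin N) (Fin N) ℂ)ˣ, u ∈ G → ‖(u : Matrix (Fin N) (Fin N) ℂ)‖ ≤ 1) (hGU : G ≤ unitaryUnits (Matrix (Fin N) (Fin N) ℂ))
    {U : CfgY (Matrix (Fin N) (Fin N) ℂ) i} {c₀ α₀ : ℝ} (hc : c₀ ≤ 10) (hMα : 0 ≤ (kGeo i).M * α₀)
    (hreg : (bg9KP (Matrix (Fin N) (Fin N) ℂ) G i).Reg335 c₀ α₀ U) {α₀' : ℝ} (hα' : 0 < α₀') (hα3 : C0 (d + 1) * α₀' ≤ 1 / 3)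
    (hα2 : 2 * α₀' ≤ c2' (d + 1) (ℓ + 1)) (hK : Kpl i ((kGeo i).M * α₀) * (kGeo i).L ^ 4 < α₀') {M₂ : ℝ} (hM₂ : 0 ≤ M₂) (hrepr : ∀ (v : Matrix (Fin N) (Fin N) ℂ) (j : ι), |b.repr v j| ≤ M₂ * ‖v‖) :
    HasMajorantHom (g := toB6 (geo9K i) Rr Hp) (fun q : BlkY i × ι => ιB q.1) (fun p : SiteY i × ι => ιB (blkOf i.D.toDomains p.1))
      (conjHom b ((QpsY i (parKnitY i) U).restrictScalars ℝ)) (fun a a' : (geo9K i).Site => if a = a' then M₂ * ∑ j, ‖b j‖ else 0) :=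
  hasMajorantHom_conjHom_QpsY i b ιB (parKnitY i) U (parKnitY_bicontractive_reg335 i hG1 hGU hc hMα hreg hα' hα3 hα2 hK) hM₂ hrepr

omit [Fintype ι] [DecidableEq ι] [Fintype (geo9K i).Site] [DecidableEq (geo9K i).Site] in
/-- ★ the `Q′`-transporters of the two letters differ by at most `8(d+1)²α₀′` on every block, for every member of (3.35) (n06-l's corner-pair lemma, level-free).
[cite: Balaban1985BackgroundPropagators, (3.19) p.393, (3.21) p.394, (3.35) p.396; Balaban1985Averaging, (44) p.24, (52)–(53) pp.26–27] -/
theorem norm_qpT_sym_sub_knit_le_reg335 [Nonempty (Fin N)]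
    (hG1 : ∀ u : (Matrix (Fin N) (Fin N) ℂ)ˣ, u ∈ G → ‖(u : Matrix (Fin N) (Fin N) ℂ)‖ ≤ 1) (hGU : G ≤ unitaryUnits (Matrix (Fin N) (Fin N) ℂ))
    {U : CfgY (Matrix (Fin N) (Fin N) ℂ) i} {c₀ α₀ : ℝ} (hc : c₀ ≤ 10) (hMα : 0 ≤ (kGeo i).M * α₀)
    (hreg : (bg9KP (Matrix (Fin N) (Fin N) ℂ) G i).Reg335 c₀ α₀ U) {α₀' : ℝ} (hα' : 0 < α₀') (hα3 : C0 (d + 1) * α₀' ≤ 1 / 3)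
    (hα2 : 2 * α₀' ≤ c2' (d + 1) (ℓ + 1)) (hK : Kpl i ((kGeo i).M * α₀) * (kGeo i).L ^ 4 < α₀') (s : BlkY i) (z : SiteY i) (hz : blkOf i.D.toDomains z = s) :
    ‖(qpT i (parSymY i) U s z : Matrix (Fin N) (Fin N) ℂ) - qpT i (parKnitY i) U s z‖ ≤ 8 * ((d : ℝ) + 1) ^ 2 * α₀' := by
  have h := norm_parKnitY_sub_parSymY_le_of_reg335P i hG1 hGU hc hMα hreg hα' hα3 hα2 hK hz
  rw [← norm_neg, neg_sub] at h
  exact h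

omit [DecidableEq ι] in
/-- ★★ `conĵ(Q′(U; parSymY) − Q′(U; parKnitY)) ≺ 𝟙[a = a′]·16(d+1)²α₀′·M₂Σ_j‖b_j‖` for every member of (3.35) — J-B 23a's `hasMajorantHom_conjHom_QpY_sym_sub_knit`
with (52) replaced by the local class + knit numerics (the displayed-`δ` core at n06-l's `δ = 8(d+1)²α₀′`).
[cite: Balaban1985BackgroundPropagators, (3.21) p.394, (3.19) p.393, (3.35) p.396; Balaban1984PropagatorsII, (2.51) p.232; Balaban1985Averaging, (17)–(20) pp.20–21, (44) p.24] -/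
theorem hasMajorantHom_conjHom_QpY_sym_sub_knit_reg335 [Nonempty (Fin N)]
    (hG1 : ∀ u : (Matrix (Fin N) (Fin N) ℂ)ˣ, u ∈ G → ‖(u : Matrix (Fin N) (Fin N) ℂ)‖ ≤ 1) (hGU : G ≤ unitaryUnits (Matrix (Fin N) (Fin N) ℂ))
    {U : CfgY (Matrix (Fin N) (Fin N) ℂ) i} {c₀ α₀ : ℝ} (hc : c₀ ≤ 10) (hMα : 0 ≤ (kGeo i).M * α₀)
    (hreg : (bg9KP (Matrix (Fin N) (Fin N) ℂ) G i).Reg335 c₀ α₀ U) {α₀' : ℝ} (hα' : 0 < α₀') (hα3 : C0 (d + 1) * α₀' ≤ 1 / 3)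
    (hα2 : 2 * α₀' ≤ c2' (d + 1) (ℓ + 1)) (hK : Kpl i ((kGeo i).M * α₀) * (kGeo i).L ^ 4 < α₀') {M₂ : ℝ} (hM₂ : 0 ≤ M₂) (hrepr : ∀ (v : Matrix (Fin N) (Fin N) ℂ) (j : ι), |b.repr v j| ≤ M₂ * ‖v‖) :
    HasMajorantHom (g := toB6 (geo9K i) Rr Hp) (fun p : SiteY i × ι => ιB (blkOf i.D.toDomains p.1)) (fun q : BlkY i × ι => ιB q.1)
      (conjHom b ((QpY i (parSymY i) U).restrictScalars ℝ - (QpY i (parKnitY i) U).restrictScalars ℝ))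
      (fun a a' : (geo9K i).Site => if a = a' then 2 * (8 * ((d : ℝ) + 1) ^ 2 * α₀') * (M₂ * ∑ j, ‖b j‖) else 0) := by
  have hU : ∀ μ x, U μ x ∈ G := fun μ x => mem_of_reg335P (G := G) i hreg μ x
  exact hasMajorantHom_conjHom_QpY_sub i b ιB (parSymY i) (parKnitY i) U (by positivity) (fun s z _ => qpT_parSymY_bicontractive i hGU hU s z)
    (fun s z _ => qpT_parKnitY_bicontractive_reg335 i hG1 hGU hc hMα hreg hα' hα3 hα2 hK s z) (fun s z hz => norm_qpT_sym_sub_knit_le_reg335 i hG1 hGU hc hMα hreg hα' hα3 hα2 hK s z hz) hM₂ hrepr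

omit [DecidableEq ι] in
/-- ★★ `conĵ(Q′*(U; parSymY) − Q′*(U; parKnitY)) ≺ 𝟙[a = a′]·16(d+1)²α₀′·M₂Σ_j‖b_j‖` for every member of (3.35) — J-B 23a's `_QpsY_sym_sub_knit` on the local class.
[cite: Balaban1985BackgroundPropagators, (3.24)–(3.25) p.394–395, (3.19) p.393, (3.35) p.396; Balaban1984PropagatorsII, (2.51) p.232; Balaban1985Averaging, (17)–(20) pp.20–21, (44) p.24] -/
theorem hasMajorantHom_conjHom_QpsY_sym_sub_knit_reg335 [Nonempty (Fin N)]
    (hG1 : ∀ u : (Matrix (Fin N) (Fin N) ℂ)ˣ, u ∈ G → ‖(u : Matrix (Fin N) (Fin N) ℂ)‖ ≤ 1) (hGU : G ≤ unitaryUnits (Matrix (Fin N) (Fin N) ℂ))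
    {U : CfgY (Matrix (Fin N) (Fin N) ℂ) i} {c₀ α₀ : ℝ} (hc : c₀ ≤ 10) (hMα : 0 ≤ (kGeo i).M * α₀)
    (hreg : (bg9KP (Matrix (Fin N) (Fin N) ℂ) G i).Reg335 c₀ α₀ U) {α₀' : ℝ} (hα' : 0 < α₀') (hα3 : C0 (d + 1) * α₀' ≤ 1 / 3)
    (hα2 : 2 * α₀' ≤ c2' (d + 1) (ℓ + 1)) (hK : Kpl i ((kGeo i).M * α₀) * (kGeo i).L ^ 4 < α₀') {M₂ : ℝ} (hM₂ : 0 ≤ M₂) (hrepr : ∀ (v : Matrix (Fin N) (Fin N) ℂ) (j : ι), |b.repr v j| ≤ M₂ * ‖v‖) :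
    HasMajorantHom (g := toB6 (geo9K i) Rr Hp) (fun q : BlkY i × ι => ιB q.1) (fun p : SiteY i × ι => ιB (blkOf i.D.toDomains p.1))
      (conjHom b ((QpsY i (parSymY i) U).restrictScalars ℝ - (QpsY i (parKnitY i) U).restrictScalars ℝ))
      (fun a a' : (geo9K i).Site => if a = a' then 2 * (8 * ((d : ℝ) + 1) ^ 2 * α₀') * (M₂ * ∑ j, ‖b j‖) else 0) := by
  have hU : ∀ μ x, U μ x ∈ G := fun μ x => mem_of_reg335P (G := G) i hreg μ x
  exact hasMajorantHom_conjHom_QpsY_sub i b ιB (parSymY i) (parKnitY i) U (by positivity) (fun s z _ => qpT_parSymY_bicontractive i hGU hU s z)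
    (fun s z _ => qpT_parKnitY_bicontractive_reg335 i hG1 hGU hc hMα hreg hα' hα3 hα2 hK s z) (fun s z hz => norm_qpT_sym_sub_knit_le_reg335 i hG1 hGU hc hMα hreg hα' hα3 hα2 hK s z hz) hM₂ hrepr

omit [DecidableEq ι] in
/-- ★★ `conĵQ′(U; parSymY) − conĵQ′(U; parKnitY) ≺ 𝟙[a = a′]·16(d+1)²α₀′·M₂Σ_j‖b_j‖` for every member of (3.35) — 2b's `hdQ` (5a §1's `_sub_pars` on the local class).
[cite: Balaban1985BackgroundPropagators, (3.21) p.394, (3.19) p.393, (3.35) p.396; Balaban1984PropagatorsII, (2.51) p.232; Balaban1985Averaging, (17)–(20) pp.20–21, (44) p.24] -/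
theorem hasMajorantHom_conjHom_QpY_sub_pars_reg335 [Nonempty (Fin N)]
    (hG1 : ∀ u : (Matrix (Fin N) (Fin N) ℂ)ˣ, u ∈ G → ‖(u : Matrix (Fin N) (Fin N) ℂ)‖ ≤ 1) (hGU : G ≤ unitaryUnits (Matrix (Fin N) (Fin N) ℂ))
    {U : CfgY (Matrix (Fin N) (Fin N) ℂ) i} {c₀ α₀ : ℝ} (hc : c₀ ≤ 10) (hMα : 0 ≤ (kGeo i).M * α₀)
    (hreg : (bg9KP (Matrix (Fin N) (Fin N) ℂ) G i).Reg335 c₀ α₀ U) {α₀' : ℝ} (hα' : 0 < α₀') (hα3 : C0 (d + 1) * α₀' ≤ 1 / 3)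
    (hα2 : 2 * α₀' ≤ c2' (d + 1) (ℓ + 1)) (hK : Kpl i ((kGeo i).M * α₀) * (kGeo i).L ^ 4 < α₀') {M₂ : ℝ} (hM₂ : 0 ≤ M₂) (hrepr : ∀ (v : Matrix (Fin N) (Fin N) ℂ) (j : ι), |b.repr v j| ≤ M₂ * ‖v‖) :
    HasMajorantHom (g := toB6 (geo9K i) Rr Hp) (fun p : SiteY i × ι => ιB (blkOf i.D.toDomains p.1)) (fun q : BlkY i × ι => ιB q.1)
      (conjHom b ((QpY i (parSymY i) U).restrictScalars ℝ) - conjHom b ((QpY i (parKnitY i) U).restrictScalars ℝ))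
      (fun a a' : (geo9K i).Site => if a = a' then 2 * (8 * ((d : ℝ) + 1) ^ 2 * α₀') * (M₂ * ∑ j, ‖b j‖) else 0) := by
  rw [← conjHom_sub]
  exact hasMajorantHom_conjHom_QpY_sym_sub_knit_reg335 i b ιB hG1 hGU hc hMα hreg hα' hα3 hα2 hK hM₂ hrepr

omit [DecidableEq ι] in
/-- ★★ `conĵQ′*(U; parSymY) − conĵQ′*(U; parKnitY) ≺ 𝟙[a = a′]·16(d+1)²α₀′·M₂Σ_j‖b_j‖` for every member of (3.35) — 2b's `hdQs`.
[cite: Balaban1985BackgroundPropagators, (3.24)–(3.25) p.394–395, (3.19) p.393, (3.35) p.396; Balaban1984PropagatorsII, (2.51) p.232; Balaban1985Averaging, (17)–(20) pp.20–21, (44) p.24] -/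
theorem hasMajorantHom_conjHom_QpsY_sub_pars_reg335 [Nonempty (Fin N)]
    (hG1 : ∀ u : (Matrix (Fin N) (Fin N) ℂ)ˣ, u ∈ G → ‖(u : Matrix (Fin N) (Fin N) ℂ)‖ ≤ 1) (hGU : G ≤ unitaryUnits (Matrix (Fin N) (Fin N) ℂ))
    {U : CfgY (Matrix (Fin N) (Fin N) ℂ) i} {c₀ α₀ : ℝ} (hc : c₀ ≤ 10) (hMα : 0 ≤ (kGeo i).M * α₀)
    (hreg : (bg9KP (Matrix (Fin N) (Fin N) ℂ) G i).Reg335 c₀ α₀ U) {α₀' : ℝ} (hα' : 0 < α₀') (hα3 : C0 (d + 1) * α₀' ≤ 1 / 3)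
    (hα2 : 2 * α₀' ≤ c2' (d + 1) (ℓ + 1)) (hK : Kpl i ((kGeo i).M * α₀) * (kGeo i).L ^ 4 < α₀') {M₂ : ℝ} (hM₂ : 0 ≤ M₂) (hrepr : ∀ (v : Matrix (Fin N) (Fin N) ℂ) (j : ι), |b.repr v j| ≤ M₂ * ‖v‖) :
    HasMajorantHom (g := toB6 (geo9K i) Rr Hp) (fun q : BlkY i × ι => ιB q.1) (fun p : SiteY i × ι => ιB (blkOf i.D.toDomains p.1))
      (conjHom b ((QpsY i (parSymY i) U).restrictScalars ℝ) - conjHom b ((QpsY i (parKnitY i) U).restrictScalars ℝ))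
      (fun a a' : (geo9K i).Site => if a = a' then 2 * (8 * ((d : ℝ) + 1) ^ 2 * α₀') * (M₂ * ∑ j, ‖b j‖) else 0) := by
  rw [← conjHom_sub]
  exact hasMajorantHom_conjHom_QpsY_sym_sub_knit_reg335 i b ιB hG1 hGU hc hMα hreg hα' hα3 hα2 hK hM₂ hrepr

end QLetters

/-! ## §2 The `G′`-sector at `(parSymY, parKnitY)` on the class (3.35) -/

section GLetters

variable {d ℓ : ℕ} {hd : 1 ≤ d + 1} {hL : Odd (ℓ + 1) ∧ 1 < ℓ + 1} {b₀ b₁ : ℝ}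
variable (i : KIdx d ℓ hd hL b₀ b₁) {N : ℕ} {G : Subgroup (Matrix (Fin N) (Fin N) ℂ)ˣ}
variable {ι : Type} [Fintype ι] [DecidableEq ι] (b : Module.Basis ι ℝ (Matrix (Fin N) (Fin N) ℂ))
variable [Fintype (geo9K i).Site] [DecidableEq (geo9K i).Site] {Rr : ℝ} {Hp : Prop} (ιB : BlkY i → IBondY i)

/-- ★★ **THE TWO-SPACE LEFT ENTRY AT THE KNIT LETTER ON (3.35)**: `conĵ(D_U)∘conj b(η²G′(U; parKnitY)) ≺ A₁(1 + c₁·θc₁(1 − θc₁)⁻¹)·ℓ(a)·e^{−(1−α)δ₀d}`,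
`θ = 32(d+1)²α₀′·M₂Σ‖b_j‖·A`, from the `parSymY` data (M5.5's (3.42)₁ majorant and the `d + 1` directional LEFT products) — p38's `hasMajorantHom_leftEntry_parKnitY` with
(52) replaced by the local class + knit numerics (file 1 §4 per direction, then r06's `conĵ(gradLin)`).
[cite: Balaban1985BackgroundPropagators, (3.42) p.397, (3.3) p.391, (3.19) p.393, (3.35) p.396, (3.90) p.409; Balaban1984PropagatorsII, (2.51)–(2.52) p.232, Lemma 2.1 p.234] -/
theorem hasMajorantHom_leftEntry_parKnitY_reg335 [Nonempty (Fin N)]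
    (hG1 : ∀ u : (Matrix (Fin N) (Fin N) ℂ)ˣ, u ∈ G → ‖(u : Matrix (Fin N) (Fin N) ℂ)‖ ≤ 1) (hGU : G ≤ unitaryUnits (Matrix (Fin N) (Fin N) ℂ))
    {U : CfgY (Matrix (Fin N) (Fin N) ℂ) i} {c₀ α₀ : ℝ} (hc : c₀ ≤ 10) (hMα : 0 ≤ (kGeo i).M * α₀)
    (hreg : (bg9KP (Matrix (Fin N) (Fin N) ℂ) G i).Reg335 c₀ α₀ U) {α₀' : ℝ} (hα' : 0 < α₀') (hα3 : C0 (d + 1) * α₀' ≤ 1 / 3)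
    (hα2 : 2 * α₀' ≤ c2' (d + 1) (ℓ + 1)) (hK : Kpl i ((kGeo i).M * α₀) * (kGeo i).L ^ 4 < α₀') (hι : ∀ s, β i.hN i.D i.hk (ιB s) = s) (hcf : i.cf = (((ℓ + 1 : ℕ) : ℝ)) ^ i.k)
    {M₂ : ℝ} (hM₂ : 0 ≤ M₂) (hrepr : ∀ (v : Matrix (Fin N) (Fin N) ℂ) (j : ι), |b.repr v j| ≤ M₂ * ‖v‖)
    (d' : ℕ) {δ₀ α A A₁ : ℝ} (hA : 0 ≤ A) (hA₁ : 0 ≤ A₁) (hαδ : 0 ≤ (1 - α) * δ₀) (hαδ' : 0 ≤ α * δ₀)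
    (htri : Triangle254 (toB6 (geo9K i) Rr Hp)) (hrefl : ∀ y : (geo9K i).Site, (geo9K i).dist y y = 0)
    (h261 : Ineq261 d' (toB6 (geo9K i) Rr Hp) δ₀ α) (h263 : Ineq263 d' (toB6 (geo9K i) Rr Hp) δ₀ α)
    {θ : ℝ} (hθ : θ = 32 * ((d : ℝ) + 1) ^ 2 * α₀' * (M₂ * ∑ j, ‖b j‖) * A) (hsmall : θ * B6.c1 d' δ₀ α < 1) (c : ℂ)
    (hGs : HasMajorant (g := toB6 (geo9K i) Rr Hp) (fun p : SiteY i × ι => ιB (blkOf i.D.toDomains p.1))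
      (conj b ((etaS i ^ 2) • (GpY i (parSymY i) U).restrictScalars ℝ))
      (fun a a' => A * (geo9K i).len a ^ 2 * Real.exp (-(δ₀ * (geo9K i).dist a a'))))
    (hDl : ∀ μ : Fin (d + 1), HasMajorant (g := toB6 (geo9K i) Rr Hp) (fun p : SiteY i × ι => ιB (blkOf i.D.toDomains p.1))
      (conj b (diffLetter (shiftY i) (UboxY i U) c (Sum.inl μ)) * conj b ((etaS i ^ 2) • (GpY i (parSymY i) U).restrictScalars ℝ))
      (fun a a' => A₁ * (geo9K i).len a * Real.exp (-(δ₀ * (geo9K i).dist a a')))) :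
    HasMajorantHom (g := toB6 (geo9K i) Rr Hp) (fun p : SiteY i × ι => ιB (blkOf i.D.toDomains p.1))
      (fun q : (Fin (d + 1) × SiteY i) × ι => ιB (blkOf i.D.toDomains q.1.2))
      (conjHom b (gradLin (shiftY i) c (UboxY i U)) ∘ₗ conj b ((etaS i ^ 2) • (GpY i (parKnitY i) U).restrictScalars ℝ))
      (fun a a' => A₁ * (1 + B6.c1 d' δ₀ α * (θ * B6.c1 d' δ₀ α * (1 - θ * B6.c1 d' δ₀ α)⁻¹)) * (geo9K i).len a
        * Real.exp (-((1 - α) * δ₀ * (geo9K i).dist a a'))) := by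
  have hdnn : ∀ y y' : (geo9K i).Site, 0 ≤ (geo9K i).dist y y' := geo9K_dist_nonneg i
  have hK : ∀ μ : Fin (d + 1), HasMajorant (g := toB6 (geo9K i) Rr Hp) (fun p : SiteY i × ι => ιB (blkOf i.D.toDomains p.1))
      (conj b (diffLetter (shiftY i) (UboxY i U) c (Sum.inl μ)) * conj b ((etaS i ^ 2) • (GpY i (parKnitY i) U).restrictScalars ℝ))
      (fun a a' => A₁ * (1 + B6.c1 d' δ₀ α * (θ * B6.c1 d' δ₀ α * (1 - θ * B6.c1 d' δ₀ α)⁻¹)) * (geo9K i).len a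
        * Real.exp (-((1 - α) * δ₀ * (geo9K i).dist a a'))) := fun μ =>
    hasMajorant_left_conj_GpY_parKnitY_of_parSymY_reg335 i b ιB hG1 hGU hc hMα hreg hα' hα3 hα2 hK hι hcf hM₂ hrepr d' (W := fun a => (geo9K i).len a)
      hA hA₁ (fun a => (geo9K_len_pos i a).le) hαδ hαδ' htri hrefl hdnn h261 h263 hθ hsmall _ hGs (hDl μ)
  exact hasMajorantHom_gradLin (g := geo9K i) (R := Rr) (H := Hp) b (shiftY i) (UboxY i U) (fun z => ιB (blkOf i.D.toDomains z)) c hK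

/-- ★★★ **THE DIFFERENCE OF THE TWO-SPACE LEFT ENTRIES ON (3.35)**: `conĵ(D_U)∘conj b(η²G′_S) − conĵ(D_U)∘conj b(η²G′_K) ≺ (B_X·θ_E·A·Λ·c₁(d_b,δ_b,β_b))·ℓ(a)·e^{−ρd}`,
`B_X = A₁(1 + c₁θc₁(1−θc₁)⁻¹)`, `θ_E = 32(d+1)²α₀′·M₂Σ‖b_j‖`, for `ρ ≥ 0`, a base rate `δ_b ≥ 0`, fractions `α_b, β_b ≥ 0` with `ρ + (α_b+β_b)δ_b ≤ (1−α)δ₀`, `Λ ≥ 1`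
and (2.61) at `(δ_b, β_b)` — `B9Ineq349WordDiffHomWeighted.hasMajorantHom_leftDiff_w` on `X₁ − X₂ = X₂∘E∘G_S` with the WEIGHTED `E` of file 1 (p38's 2c-i conclusion VERBATIM; the transfer
of `ℓ²` is no longer needed).  [cite: Balaban1985BackgroundPropagators, (3.42) p.397, (3.90) p.409, (3.106) p.414, (3.35) p.396; Balaban1984PropagatorsII, (2.50)–(2.52) p.232, Lemma 2.1 (2.60)–(2.61) p.234; Balaban1985Averaging, (44) p.24] -/
theorem hasMajorantHom_leftEntry_sym_sub_knit_reg335 [Nonempty (Fin N)]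
    (hG1 : ∀ u : (Matrix (Fin N) (Fin N) ℂ)ˣ, u ∈ G → ‖(u : Matrix (Fin N) (Fin N) ℂ)‖ ≤ 1) (hGU : G ≤ unitaryUnits (Matrix (Fin N) (Fin N) ℂ))
    {U : CfgY (Matrix (Fin N) (Fin N) ℂ) i} {c₀ α₀ : ℝ} (hc : c₀ ≤ 10) (hMα : 0 ≤ (kGeo i).M * α₀)
    (hreg : (bg9KP (Matrix (Fin N) (Fin N) ℂ) G i).Reg335 c₀ α₀ U) {α₀' : ℝ} (hα' : 0 < α₀') (hα3 : C0 (d + 1) * α₀' ≤ 1 / 3)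
    (hα2 : 2 * α₀' ≤ c2' (d + 1) (ℓ + 1)) (hK : Kpl i ((kGeo i).M * α₀) * (kGeo i).L ^ 4 < α₀') (hι : ∀ s, β i.hN i.D i.hk (ιB s) = s) (hcf : i.cf = (((ℓ + 1 : ℕ) : ℝ)) ^ i.k)
    {M₂ : ℝ} (hM₂ : 0 ≤ M₂) (hrepr : ∀ (v : Matrix (Fin N) (Fin N) ℂ) (j : ι), |b.repr v j| ≤ M₂ * ‖v‖)
    (d' : ℕ) {δ₀ α A A₁ : ℝ} (hA : 0 ≤ A) (hA₁ : 0 ≤ A₁) (hαδ : 0 ≤ (1 - α) * δ₀) (hαδ' : 0 ≤ α * δ₀)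
    (htri : Triangle254 (toB6 (geo9K i) Rr Hp)) (hrefl : ∀ y : (geo9K i).Site, (geo9K i).dist y y = 0)
    (h261 : Ineq261 d' (toB6 (geo9K i) Rr Hp) δ₀ α) (h263 : Ineq263 d' (toB6 (geo9K i) Rr Hp) δ₀ α)
    {θ : ℝ} (hθ : θ = 32 * ((d : ℝ) + 1) ^ 2 * α₀' * (M₂ * ∑ j, ‖b j‖) * A) (hsmall : θ * B6.c1 d' δ₀ α < 1) (c : ℂ)
    (hGs : HasMajorant (g := toB6 (geo9K i) Rr Hp) (fun p : SiteY i × ι => ιB (blkOf i.D.toDomains p.1))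
      (conj b ((etaS i ^ 2) • (GpY i (parSymY i) U).restrictScalars ℝ))
      (fun a a' => A * (geo9K i).len a ^ 2 * Real.exp (-(δ₀ * (geo9K i).dist a a'))))
    (hDl : ∀ μ : Fin (d + 1), HasMajorant (g := toB6 (geo9K i) Rr Hp) (fun p : SiteY i × ι => ιB (blkOf i.D.toDomains p.1))
      (conj b (diffLetter (shiftY i) (UboxY i U) c (Sum.inl μ)) * conj b ((etaS i ^ 2) • (GpY i (parSymY i) U).restrictScalars ℝ))
      (fun a a' => A₁ * (geo9K i).len a * Real.exp (-(δ₀ * (geo9K i).dist a a'))))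
    (db : ℕ) {δb αb βb ρ Λ : ℝ} (hΛ : 1 ≤ Λ) (hρ : 0 ≤ ρ) (hαb : 0 ≤ αb) (hβb : 0 ≤ βb) (hδb : 0 ≤ δb) (hr : ρ + (αb + βb) * δb ≤ (1 - α) * δ₀)
    (h261b : Ineq261 db (toB6 (geo9K i) Rr Hp) δb βb) :
    HasMajorantHom (g := toB6 (geo9K i) Rr Hp) (fun p : SiteY i × ι => ιB (blkOf i.D.toDomains p.1))
      (fun q : (Fin (d + 1) × SiteY i) × ι => ιB (blkOf i.D.toDomains q.1.2))
      (conjHom b (gradLin (shiftY i) c (UboxY i U)) ∘ₗ conj b ((etaS i ^ 2) • (GpY i (parSymY i) U).restrictScalars ℝ) -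
        conjHom b (gradLin (shiftY i) c (UboxY i U)) ∘ₗ conj b ((etaS i ^ 2) • (GpY i (parKnitY i) U).restrictScalars ℝ))
      (fun a a' => (A₁ * (1 + B6.c1 d' δ₀ α * (θ * B6.c1 d' δ₀ α * (1 - θ * B6.c1 d' δ₀ α)⁻¹)) * (32 * ((d : ℝ) + 1) ^ 2 * α₀' * (M₂ * ∑ j, ‖b j‖))
          * A * Λ * B6.c1 db δb βb) * (geo9K i).len a * Real.exp (-(ρ * (geo9K i).dist a a'))) := by
  have hU : ∀ μ x, U μ x ∈ G := fun μ x => mem_of_reg335P (G := G) i hreg μ x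
  have hUu : ∀ μ x, U μ x ∈ unitaryUnits (Matrix (Fin N) (Fin N) ℂ) := fun μ x => hGU (hU μ x)
  have hpar : ∀ z w : SiteY i, parKnitY i U z w ∈ unitaryUnits (Matrix (Fin N) (Fin N) ℂ) :=
    fun z w => parKnitY_mem_unitary_of_reg335P i hG1 hGU U hc hMα hreg hα' hα3 hα2 hK z w
  have hη : etaS i ≠ 0 := (etaS_pos i).ne'
  have hdnn : ∀ y y' : (geo9K i).Site, 0 ≤ (geo9K i).dist y y' := geo9K_dist_nonneg i
  have hc0 : 0 ≤ B6.c1 d' δ₀ α := c1_nonneg d' δ₀ α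
  have hθ0 : 0 ≤ θ := by rw [hθ]; exact mul_nonneg (mul_nonneg (by positivity) (mul_nonneg hM₂ (Finset.sum_nonneg fun j _ => norm_nonneg _))) hA
  have hinv : 0 ≤ (1 - θ * B6.c1 d' δ₀ α)⁻¹ := inv_nonneg.2 (by linarith)
  have hBX : 0 ≤ A₁ * (1 + B6.c1 d' δ₀ α * (θ * B6.c1 d' δ₀ α * (1 - θ * B6.c1 d' δ₀ α)⁻¹)) :=
    mul_nonneg hA₁ (add_nonneg zero_le_one (mul_nonneg hc0 (mul_nonneg (mul_nonneg hθ0 hc0) hinv)))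
  have hθE : 0 ≤ 32 * ((d : ℝ) + 1) ^ 2 * α₀' * (M₂ * ∑ j, ‖b j‖) :=
    mul_nonneg (by positivity) (mul_nonneg hM₂ (Finset.sum_nonneg fun j _ => norm_nonneg _))
  have hX₂ := hasMajorantHom_leftEntry_parKnitY_reg335 i b ιB (Rr := Rr) (Hp := Hp) hG1 hGU hc hMα hreg hα' hα3 hα2 hK hι hcf hM₂ hrepr d' hA hA₁ hαδ hαδ' htri hrefl
    h261 h263 hθ hsmall c hGs hDl
  have hE := hasMajorant_conj_E_reg335 i b ιB (Rr := Rr) (Hp := Hp) hG1 hGU hc hMα hreg hα' hα3 hα2 hK hι hcf hM₂ hrepr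
  have hG₁ : HasMajorant (g := toB6 (geo9K i) Rr Hp) (fun p : SiteY i × ι => ιB (blkOf i.D.toDomains p.1))
      (conj b ((etaS i ^ 2) • (GpY i (parSymY i) U).restrictScalars ℝ))
      (fun a a' => A * (geo9K i).len a ^ 2 * Real.exp (-((1 - α) * δ₀ * (geo9K i).dist a a'))) := by
    refine hasMajorant_mono (g := toB6 (geo9K i) Rr Hp) _ hGs fun a a' => ?_
    exact mul_le_mul_of_nonneg_left (Real.exp_le_exp.2 (by nlinarith [hdnn a a', hαδ'])) (mul_nonneg hA (sq_nonneg _))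
  rw [leftEntry_sub_eq i b le_rfl hUu hpar hη]
  exact hasMajorantHom_leftDiff_w (R := Rr) (H := Hp) (fun p : SiteY i × ι => ιB (blkOf i.D.toDomains p.1))
    (fun q : (Fin (d + 1) × SiteY i) × ι => ιB (blkOf i.D.toDomains q.1.2)) db δb ((1 - α) * δ₀) αb βb ρ Λ _ _ A hBX hθE hA hΛ hρ hαb hβb hδb hr
    hdnn htri (geo9K_len_pos i) h261b hX₂ hE hG₁

/-- ★★★ **THE DIFFERENCE OF THE TWO-SPACE RIGHT ENTRIES ON (3.35)**: `conj b(η²G′_S)∘conĵ(D*_U) − conj b(η²G′_K)∘conĵ(D*_U) ≺ (A_K·θ_E·(d+1)A₂·Λ·c₁(d_b,δ_b,β_b))·ℓ(a)·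
e^{−ρd}`, `A_K = Ac₁(1 − θc₁)⁻¹` (file 1 §3), from the `parSymY` data and the `d + 1` directional RIGHT products at `parSymY`, the transfer of `ℓ⁻¹` at `(δ_b, α_b, Λ)`
(the weighted `E` sits against the `ℓ` of the right entry), (2.61) at `(δ_b, β_b)`, `ρ + (α_b+β_b)δ_b ≤ (1−α)δ₀` — `B9Ineq349WordDiffHomWeighted.hasMajorantHom_rightDiff_w` on
`Y₁ − Y₂ = G_K∘E∘Y₁` (p38's 2c-i conclusion VERBATIM).  [cite: Balaban1985BackgroundPropagators, (3.42) p.397, (3.90) p.409, (3.106) p.414, (3.35) p.396; Balaban1984PropagatorsII, (2.50)–(2.52) p.232, Lemma 2.1 (2.60)–(2.61) p.234; Balaban1985Averaging, (44) p.24] -/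
theorem hasMajorantHom_rightEntry_sym_sub_knit_reg335 [Nonempty (Fin N)]
    (hG1 : ∀ u : (Matrix (Fin N) (Fin N) ℂ)ˣ, u ∈ G → ‖(u : Matrix (Fin N) (Fin N) ℂ)‖ ≤ 1) (hGU : G ≤ unitaryUnits (Matrix (Fin N) (Fin N) ℂ))
    {U : CfgY (Matrix (Fin N) (Fin N) ℂ) i} {c₀ α₀ : ℝ} (hc : c₀ ≤ 10) (hMα : 0 ≤ (kGeo i).M * α₀)
    (hreg : (bg9KP (Matrix (Fin N) (Fin N) ℂ) G i).Reg335 c₀ α₀ U) {α₀' : ℝ} (hα' : 0 < α₀') (hα3 : C0 (d + 1) * α₀' ≤ 1 / 3)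
    (hα2 : 2 * α₀' ≤ c2' (d + 1) (ℓ + 1)) (hK : Kpl i ((kGeo i).M * α₀) * (kGeo i).L ^ 4 < α₀') (hι : ∀ s, β i.hN i.D i.hk (ιB s) = s) (hcf : i.cf = (((ℓ + 1 : ℕ) : ℝ)) ^ i.k)
    {M₂ : ℝ} (hM₂ : 0 ≤ M₂) (hrepr : ∀ (v : Matrix (Fin N) (Fin N) ℂ) (j : ι), |b.repr v j| ≤ M₂ * ‖v‖)
    (d' : ℕ) {δ₀ α A A₂ : ℝ} (hA : 0 ≤ A) (hA₂ : 0 ≤ A₂) (hαδ : 0 ≤ (1 - α) * δ₀) (hαδ' : 0 ≤ α * δ₀)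
    (htri : Triangle254 (toB6 (geo9K i) Rr Hp)) (hrefl : ∀ y : (geo9K i).Site, (geo9K i).dist y y = 0)
    (h261 : Ineq261 d' (toB6 (geo9K i) Rr Hp) δ₀ α) (h263 : Ineq263 d' (toB6 (geo9K i) Rr Hp) δ₀ α)
    (hsmall : (32 * ((d : ℝ) + 1) ^ 2 * α₀' * (M₂ * ∑ j, ‖b j‖) * A) * B6.c1 d' δ₀ α < 1) (c : ℂ)
    (hGs : HasMajorant (g := toB6 (geo9K i) Rr Hp) (fun p : SiteY i × ι => ιB (blkOf i.D.toDomains p.1))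
      (conj b ((etaS i ^ 2) • (GpY i (parSymY i) U).restrictScalars ℝ))
      (fun a a' => A * (geo9K i).len a ^ 2 * Real.exp (-(δ₀ * (geo9K i).dist a a'))))
    (hDr : ∀ ν : Fin (d + 1), HasMajorant (g := toB6 (geo9K i) Rr Hp) (fun p : SiteY i × ι => ιB (blkOf i.D.toDomains p.1))
      (conj b ((etaS i ^ 2) • (GpY i (parSymY i) U).restrictScalars ℝ) * conj b (diffLetter (shiftY i) (UboxY i U) c (Sum.inr ν)))
      (fun a a' => A₂ * (geo9K i).len a * Real.exp (-(δ₀ * (geo9K i).dist a a'))))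
    (db : ℕ) {δb αb βb ρ Λ : ℝ} (hΛ : 0 ≤ Λ) (hρ : 0 ≤ ρ) (hαb : 0 ≤ αb) (hβb : 0 ≤ βb) (hδb : 0 ≤ δb) (hr : ρ + (αb + βb) * δb ≤ (1 - α) * δ₀)
    (h261b : Ineq261 db (toB6 (geo9K i) Rr Hp) δb βb) (hT1i : ScaleTransfer (geo9K i) δb αb Λ (fun a => ((geo9K i).len a)⁻¹)) :
    HasMajorantHom (g := toB6 (geo9K i) Rr Hp) (fun q : (Fin (d + 1) × SiteY i) × ι => ιB (blkOf i.D.toDomains q.1.2))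
      (fun p : SiteY i × ι => ιB (blkOf i.D.toDomains p.1))
      (conj b ((etaS i ^ 2) • (GpY i (parSymY i) U).restrictScalars ℝ) ∘ₗ conjHom b (divLin (shiftY i) c (UboxY i U)) -
        conj b ((etaS i ^ 2) • (GpY i (parKnitY i) U).restrictScalars ℝ) ∘ₗ conjHom b (divLin (shiftY i) c (UboxY i U)))
      (fun a a' => (A * B6.c1 d' δ₀ α * (1 - (32 * ((d : ℝ) + 1) ^ 2 * α₀' * (M₂ * ∑ j, ‖b j‖) * A) * B6.c1 d' δ₀ α)⁻¹
          * (32 * ((d : ℝ) + 1) ^ 2 * α₀' * (M₂ * ∑ j, ‖b j‖)) * (((d : ℝ) + 1) * A₂) * Λ * B6.c1 db δb βb)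
        * (geo9K i).len a * Real.exp (-(ρ * (geo9K i).dist a a'))) := by
  have hU : ∀ μ x, U μ x ∈ G := fun μ x => mem_of_reg335P (G := G) i hreg μ x
  have hUu : ∀ μ x, U μ x ∈ unitaryUnits (Matrix (Fin N) (Fin N) ℂ) := fun μ x => hGU (hU μ x)
  have hpar : ∀ z w : SiteY i, parKnitY i U z w ∈ unitaryUnits (Matrix (Fin N) (Fin N) ℂ) :=
    fun z w => parKnitY_mem_unitary_of_reg335P i hG1 hGU U hc hMα hreg hα' hα3 hα2 hK z w
  have hη : etaS i ≠ 0 := (etaS_pos i).ne'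
  have hdnn : ∀ y y' : (geo9K i).Site, 0 ≤ (geo9K i).dist y y' := geo9K_dist_nonneg i
  have hc0 : 0 ≤ B6.c1 d' δ₀ α := c1_nonneg d' δ₀ α
  have hθE : 0 ≤ 32 * ((d : ℝ) + 1) ^ 2 * α₀' * (M₂ * ∑ j, ‖b j‖) :=
    mul_nonneg (by positivity) (mul_nonneg hM₂ (Finset.sum_nonneg fun j _ => norm_nonneg _))
  have hinv : 0 ≤ (1 - (32 * ((d : ℝ) + 1) ^ 2 * α₀' * (M₂ * ∑ j, ‖b j‖) * A) * B6.c1 d' δ₀ α)⁻¹ := inv_nonneg.2 (by linarith)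
  have hAK : 0 ≤ A * B6.c1 d' δ₀ α * (1 - (32 * ((d : ℝ) + 1) ^ 2 * α₀' * (M₂ * ∑ j, ‖b j‖) * A) * B6.c1 d' δ₀ α)⁻¹ :=
    mul_nonneg (mul_nonneg hA hc0) hinv
  have hBY : 0 ≤ ((d : ℝ) + 1) * A₂ := mul_nonneg (by positivity) hA₂
  have hG₂ := hasMajorant_conj_GpY_parKnitY_of_parSymY_reg335 i b ιB (Rr := Rr) (Hp := Hp) hG1 hGU hc hMα hreg hα' hα3 hα2 hK hι hcf hM₂ hrepr d' hA hαδ htri hrefl hdnn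
    h261 h263 hsmall hGs
  have hE := hasMajorant_conj_E_reg335 i b ιB (Rr := Rr) (Hp := Hp) hG1 hGU hc hMα hreg hα' hα3 hα2 hK hι hcf hM₂ hrepr
  have hY₁ : HasMajorantHom (g := toB6 (geo9K i) Rr Hp) (fun q : (Fin (d + 1) × SiteY i) × ι => ιB (blkOf i.D.toDomains q.1.2))
      (fun p : SiteY i × ι => ιB (blkOf i.D.toDomains p.1))
      (conj b ((etaS i ^ 2) • (GpY i (parSymY i) U).restrictScalars ℝ) ∘ₗ conjHom b (divLin (shiftY i) c (UboxY i U)))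
      (fun a a' => ((d : ℝ) + 1) * A₂ * (geo9K i).len a * Real.exp (-((1 - α) * δ₀ * (geo9K i).dist a a'))) := by
    refine hasMajorantHom_mono (g := toB6 (geo9K i) Rr Hp) _ _ (hasMajorantHom_rightEntry_parSymY i b ιB (Rr := Rr) (Hp := Hp) U c hDr) fun a a' => ?_
    exact mul_le_mul_of_nonneg_left (Real.exp_le_exp.2 (by nlinarith [hdnn a a', hαδ'])) (mul_nonneg hBY (geo9K_len_pos i a).le)
  rw [rightEntry_sub_eq i b le_rfl hUu hpar hη]
  exact hasMajorantHom_rightDiff_w (R := Rr) (H := Hp) (fun q : (Fin (d + 1) × SiteY i) × ι => ιB (blkOf i.D.toDomains q.1.2))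
    (fun p : SiteY i × ι => ιB (blkOf i.D.toDomains p.1)) db δb ((1 - α) * δ₀) αb βb ρ Λ _ _ _ hAK hθE hBY hΛ hρ hαb hβb hδb hr
    hdnn htri (geo9K_len_pos i) h261b hT1i hG₂ hE hY₁

end GLetters

end Literature.MathematicalPhysics.QuantumFieldTheory.Balaban1983to89.B9B8KnitBondGpQLettersAtParsReg335

end
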